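import Summits.QuantumAdvantage.QuantumAdvantage.Theses.CubicForrelation

/-!
# `NearExactIsExact` (stmt-QuantumAdvantage-14043), line `direct-sum-amplification` — rank-two pencils (RP), part 1:
planes over `ZMod 2` and alternating matrices of rank at most two

Support file for the stub `stub_rankTwoPencil` (`…Theorems/CubicForrelationNearExactIsExactRankTwoPencil.lean`) of
the line `direct-sum-amplification` for the crux
`Summit.QuantumAdvantage.QuantumAdvantage.Theses.CubicForrelation.NearExactIsExact`.  Elementary linear algebra over
`ZMod 2`, with no rank API: vectors are `Fin k → ZMod 2`, matrices `Fin k → Fin k → ZMod 2`, planes are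
`Submodule.span (ZMod 2) {u, v} = {0, u, v, u + v}`.

* Planes (`rp_K_cases`, `rp_K_gen`, `rp_rebase`): the four elements of `⟨u, v⟩`; two distinct non-zero elements of
  a plane generate it; a plane through `w ≠ 0` is `⟨w, u₂⟩`.
* Normal form (`rp_nf`, `rp_col`, `rp_cols`): a symmetric zero-diagonal matrix `B` satisfying the Plücker/Pfaffian
  identities `B_{ij}B_{i′j′} + B_{ii′}B_{jj′} + B_{ij′}B_{ji′} = 0` with `B p q = 1` has
  `B l t = B p l · B q t + B q l · B p t` (Plücker at `(p, q, l, t)`), i.e. `B = row_p ∧ row_q`: all rows and columns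
  lie in the plane `P(B) = ⟨row_p, row_q⟩`, whose three non-zero elements are `row_p, row_q, row_p + row_q`
  (`B q p = 1`, `B p p = B q q = 0`); elements of `P(B)` are row combinations `Σ_i s_i · row_i(B)` (`rp_inIm`).
* TWO PLANES MEET (`rp_planesMeet`): if `B = u ∧ v`, `B′ = u′ ∧ v′` are in normal form and all columns of `C = B + B′` lie
  in one plane `Q` (rank `C ≤ 2`), then `P(B) ∩ P(B′) ≠ 0`.  Proof without dual vectors: if `P ∩ P′ = 0`, the
  columns `p, q` of `C` are `u + γ`, `v + δ` (`γ, δ` the columns `p, q` of `B′`), distinct and non-zero, so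
  `Q = {0, u + γ, v + δ, u + v + γ + δ}` and `Q ∩ P′ = 0`; for every `t`,
  `col_t B′ + v_t γ + u_t δ = col_t C + v_t (u + γ) + u_t (v + δ) ∈ Q ∩ P′`, whence `B′ l t = v_t γ_l + u_t δ_l`:
  every ROW of `B′` lies in `P`, and (symmetry) in `P′`, so `B′ = 0` — contradicting `B′ p′ q′ = 1`.

References (orientation only; everything here is proved): folklore linear algebra over `𝔽₂`.
-/

set_option linter.dupNamespace false -- D-0017: single-problem summit

namespace Summit.QuantumAdvantage.QuantumAdvantage.Theorems.CubicForrelation.NearExactIsExact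

open Finset
open Submodule (span)

/-! ### Arithmetic in characteristic two and the Bool dictionary -/

/-- `a + b = c + d → a + c = b + d` in `ZMod 2`. [folklore] -/
theorem rp_s_swap : ∀ a b c d : ZMod 2, a + b = c + d → a + c = b + d := by decide

/-- `a + b + c = 0 → a = b + c` in `ZMod 2`. [folklore] -/
theorem rp_s_three : ∀ a b c : ZMod 2, a + b + c = 0 → a = b + c := by decide

/-- `a + b = a + g + (b + d) + (g + d)` in `ZMod 2`. [folklore] -/
theorem rp_s_four : ∀ a g b d : ZMod 2, a + b = a + g + (b + d) + (g + d) := by decide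

/-- `[decide (a = 1)] = a` in `ZMod 2`. [folklore] -/
theorem rp_b_dec : ∀ a : ZMod 2, (if decide (a = 1) then (1 : ZMod 2) else 0) = a := by decide

/-- `[b] = 0 ↔ b = false`. [folklore] -/
theorem rp_b_zero_iff : ∀ b : Bool, (if b then (1 : ZMod 2) else 0) = 0 ↔ b = false := by decide

/-- The Plücker relation passes from `Bool` to `ZMod 2`. [folklore] -/
theorem rp_b_pl : ∀ a b c d e f : Bool, ((a && b) ^^ (c && d) ^^ (e && f)) = false →
    (if a then (1 : ZMod 2) else 0) * (if b then (1 : ZMod 2) else 0) +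
      (if c then (1 : ZMod 2) else 0) * (if d then (1 : ZMod 2) else 0) +
      (if e then (1 : ZMod 2) else 0) * (if f then (1 : ZMod 2) else 0) = 0 := by decide

/-- `y + (y + y') = y'` for vectors over `ZMod 2`. [folklore] -/
theorem rp_add_cancel_left {k : ℕ} (y y' : Fin k → ZMod 2) : y + (y + y') = y' :=
  funext fun l => CharTwo.add_cancel_left (y l) (y' l)

/-- `y + y' + y' = y` for vectors over `ZMod 2`. [folklore] -/
theorem rp_add_cancel_right {k : ℕ} (y y' : Fin k → ZMod 2) : y + y' + y' = y :=
  funext fun l => CharTwo.add_cancel_right (y l) (y' l)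

/-- `y + y' = 0 → y = y'` for vectors over `ZMod 2`. [folklore] -/
theorem rp_eq_of_add_eq_zero {k : ℕ} {y y' : Fin k → ZMod 2} (h : y + y' = 0) : y = y' := by
  calc y = y + y' + y' := (rp_add_cancel_right y y').symm
    _ = y' := by rw [h, zero_add]

/-- `a + b = c + d → a + c = b + d` for vectors over `ZMod 2`. [folklore] -/
theorem rp_swap_eq {k : ℕ} {a b c d : Fin k → ZMod 2} (h : a + b = c + d) : a + c = b + d :=
  funext fun l => rp_s_swap _ _ _ _ (congrFun h l)

/-! ### Planes `⟨u, v⟩ = {0, u, v, u + v}` over `ZMod 2` -/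

/-- `u ∈ ⟨u, v⟩`. [folklore] -/
theorem rp_inl {k : ℕ} (u v : Fin k → ZMod 2) : u ∈ span (ZMod 2) ({u, v} : Set (Fin k → ZMod 2)) :=
  Submodule.subset_span (Set.mem_insert _ _)

/-- `v ∈ ⟨u, v⟩`. [folklore] -/
theorem rp_inr {k : ℕ} (u v : Fin k → ZMod 2) : v ∈ span (ZMod 2) ({u, v} : Set (Fin k → ZMod 2)) :=
  Submodule.subset_span (Set.mem_insert_of_mem _ (Set.mem_singleton _))

/-- The four elements of `⟨u, v⟩`. [folklore] -/
theorem rp_K_cases {k : ℕ} {u v y : Fin k → ZMod 2} (hy : y ∈ span (ZMod 2) ({u, v} : Set (Fin k → ZMod 2))) :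
    y = 0 ∨ y = u ∨ y = v ∨ y = u + v := by
  obtain ⟨α, β, rfl⟩ := Submodule.mem_span_pair.1 hy
  have zc : ∀ a : ZMod 2, a = 0 ∨ a = 1 := by decide
  rcases zc α with rfl | rfl <;> rcases zc β with rfl | rfl <;> simp

/-- A pair inside a subspace spans a subspace of it. [folklore] -/
theorem rp_span_pair_le {k : ℕ} {S : Submodule (ZMod 2) (Fin k → ZMod 2)} {e₁ e₂ : Fin k → ZMod 2}
    (h1 : e₁ ∈ S) (h2 : e₂ ∈ S) : span (ZMod 2) ({e₁, e₂} : Set (Fin k → ZMod 2)) ≤ S := by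
  refine Submodule.span_le.2 ?_
  intro t ht
  simp only [Set.mem_insert_iff, Set.mem_singleton_iff] at ht
  rcases ht with rfl | rfl
  · exact h1
  · exact h2

/-- Two distinct non-zero elements `a, b` of the plane `⟨x, z⟩` generate it: `x, z ∈ ⟨a, b⟩`. [folklore] -/
theorem rp_K_gen {k : ℕ} {x z a b : Fin k → ZMod 2} (ha : a ∈ span (ZMod 2) ({x, z} : Set (Fin k → ZMod 2)))
    (hb : b ∈ span (ZMod 2) ({x, z} : Set (Fin k → ZMod 2))) (ha0 : a ≠ 0) (hb0 : b ≠ 0) (hab : a ≠ b) :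
    x ∈ span (ZMod 2) ({a, b} : Set (Fin k → ZMod 2)) ∧ z ∈ span (ZMod 2) ({a, b} : Set (Fin k → ZMod 2)) := by
  have e1 : x + (x + z) = z := rp_add_cancel_left x z
  have e2 : z + (x + z) = x := by rw [add_comm x z]; exact rp_add_cancel_left z x
  have e3 : x + z + x = z := by rw [add_comm x z]; exact rp_add_cancel_right z x
  have e4 : x + z + z = x := rp_add_cancel_right x z
  rcases rp_K_cases ha with h | h | h | h
  · exact absurd h ha0
  · rw [h] at hab ⊢
    rcases rp_K_cases hb with h' | h' | h' | h'
    · exact absurd h' hb0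
    · exact absurd h'.symm hab
    · rw [h']; exact ⟨rp_inl _ _, rp_inr _ _⟩
    · rw [h']
      refine ⟨rp_inl _ _, ?_⟩
      have := Submodule.add_mem _ (rp_inl x (x + z)) (rp_inr x (x + z))
      rwa [e1] at this
  · rw [h] at hab ⊢
    rcases rp_K_cases hb with h' | h' | h' | h'
    · exact absurd h' hb0
    · rw [h']; exact ⟨rp_inr _ _, rp_inl _ _⟩
    · exact absurd h'.symm hab
    · rw [h']
      refine ⟨?_, rp_inl _ _⟩
      have := Submodule.add_mem _ (rp_inl z (x + z)) (rp_inr z (x + z))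
      rwa [e2] at this
  · rw [h] at hab ⊢
    rcases rp_K_cases hb with h' | h' | h' | h'
    · exact absurd h' hb0
    · rw [h']
      refine ⟨rp_inr _ _, ?_⟩
      have := Submodule.add_mem _ (rp_inl (x + z) x) (rp_inr (x + z) x)
      rwa [e3] at this
    · rw [h']
      refine ⟨?_, rp_inr _ _⟩
      have := Submodule.add_mem _ (rp_inl (x + z) z) (rp_inr (x + z) z)
      rwa [e4] at this
    · exact absurd h'.symm hab

/-- A plane containing `w ≠ 0` can be re-based at `w`: `⟨u, v⟩ = ⟨w, u₂⟩` with `u₂ ≠ 0, w`. [folklore] -/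
theorem rp_rebase {k : ℕ} {u v w : Fin k → ZMod 2} {p q : Fin k} (hup : u p = 0) (huq : u q = 1)
    (hvp : v p = 1) (hw : w ∈ span (ZMod 2) ({u, v} : Set (Fin k → ZMod 2))) (hw0 : w ≠ 0) :
    ∃ u₂ : Fin k → ZMod 2, u₂ ≠ 0 ∧ u₂ ≠ w ∧
      span (ZMod 2) ({u, v} : Set (Fin k → ZMod 2)) = span (ZMod 2) ({w, u₂} : Set (Fin k → ZMod 2)) := by
  have hu0 : u ≠ 0 := fun h => by
    have := congrFun h q; rw [huq] at this; exact one_ne_zero this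
  have hv0 : v ≠ 0 := fun h => by
    have := congrFun h p; rw [hvp] at this; exact one_ne_zero this
  have huv : u ≠ v := fun h => by
    have := congrFun h p; rw [hup, hvp] at this; exact zero_ne_one this
  have huuv : u ≠ u + v := fun h => by
    have := congrFun h p; rw [Pi.add_apply, hup, hvp, zero_add] at this; exact zero_ne_one this
  have key : ∀ a b : Fin k → ZMod 2, a ∈ span (ZMod 2) ({u, v} : Set (Fin k → ZMod 2)) →
      b ∈ span (ZMod 2) ({u, v} : Set (Fin k → ZMod 2)) → a ≠ 0 → b ≠ 0 → a ≠ b →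
      span (ZMod 2) ({u, v} : Set (Fin k → ZMod 2)) = span (ZMod 2) ({a, b} : Set (Fin k → ZMod 2)) := by
    intro a b ha hb ha0 hb0 hab
    obtain ⟨h1, h2⟩ := rp_K_gen ha hb ha0 hb0 hab
    exact le_antisymm (rp_span_pair_le h1 h2) (rp_span_pair_le ha hb)
  rcases rp_K_cases hw with h | h | h | h
  · exact absurd h hw0
  · refine ⟨v, hv0, fun e => huv (e.trans h).symm, key w v hw (rp_inr u v) hw0 hv0 ?_⟩
    rw [h]; exact huv
  · refine ⟨u, hu0, fun e => huv (e.trans h), key w u hw (rp_inl u v) hw0 hu0 ?_⟩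
    rw [h]; exact fun e => huv e.symm
  · refine ⟨u, hu0, fun e => huuv (e.trans h), key w u hw (rp_inl u v) hw0 hu0 ?_⟩
    rw [h]; exact fun e => huuv e.symm

/-- `⟨w, u₁⟩ ≤ ⟨w, u₁, u₂⟩` and `⟨w, u₂⟩ ≤ ⟨w, u₁, u₂⟩`. [folklore] -/
theorem rp_pair_le_triple {k : ℕ} (w u₁ u₂ : Fin k → ZMod 2) :
    span (ZMod 2) ({w, u₁} : Set (Fin k → ZMod 2)) ≤ span (ZMod 2) ({w, u₁, u₂} : Set (Fin k → ZMod 2)) ∧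
      span (ZMod 2) ({w, u₂} : Set (Fin k → ZMod 2)) ≤ span (ZMod 2) ({w, u₁, u₂} : Set (Fin k → ZMod 2)) := by
  constructor
  · refine Submodule.span_mono fun t ht => ?_
    simp only [Set.mem_insert_iff, Set.mem_singleton_iff] at ht ⊢
    tauto
  · refine Submodule.span_mono fun t ht => ?_
    simp only [Set.mem_insert_iff, Set.mem_singleton_iff] at ht ⊢
    tauto

/-! ### Alternating matrices of rank at most two over `ZMod 2` -/

/-- A non-zero matrix over `ZMod 2` has an entry equal to `1`. [folklore] -/
theorem rp_exists_one {k : ℕ} {B : Fin k → Fin k → ZMod 2} (hB : B ≠ 0) : ∃ p q, B p q = 1 := by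
  by_contra h
  push Not at h
  apply hB
  funext p q
  rcases (by decide : ∀ a : ZMod 2, a = 0 ∨ a = 1) (B p q) with h' | h'
  · exact h'
  · exact absurd h' (h p q)

/-- NORMAL FORM.  In a symmetric zero-diagonal matrix over `ZMod 2` satisfying the Plücker identities, an entry
`B p q = 1` forces `B l t = B p l · B q t + B q l · B p t` (so `B = row_p ∧ row_q`), and `B p p = 0`,
`B q p = 1`, `B q q = 0`. [folklore] -/
theorem rp_nf {k : ℕ} {B : Fin k → Fin k → ZMod 2} (hd : ∀ i, B i i = 0) (hs : ∀ i j, B i j = B j i)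
    (hpl : ∀ i j i' j', B i j * B i' j' + B i i' * B j j' + B i j' * B j i' = 0) {p q : Fin k}
    (hpq : B p q = 1) :
    (∀ l t, B l t = B p l * B q t + B q l * B p t) ∧ B p p = 0 ∧ B q p = 1 ∧ B q q = 0 := by
  refine ⟨fun l t => ?_, hd p, (hs q p).trans hpq, hd q⟩
  have h := hpl p q l t
  rw [hpq, one_mul] at h
  rw [rp_s_three _ _ _ h, mul_comm (B p t)]

/-- In normal form every column of `B` lies in the plane `⟨row_p, row_q⟩`. [folklore] -/
theorem rp_col {k : ℕ} {B : Fin k → Fin k → ZMod 2} {p q : Fin k}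
    (hB : ∀ l t, B l t = B p l * B q t + B q l * B p t) (t : Fin k) :
    (fun l => B l t) ∈ span (ZMod 2) ({B p, B q} : Set (Fin k → ZMod 2)) :=
  Submodule.mem_span_pair.2 ⟨B q t, B p t, funext fun l => by
    simp only [Pi.add_apply, Pi.smul_apply, smul_eq_mul]
    rw [hB l t]; ring⟩

/-- The columns of a symmetric zero-diagonal Plücker matrix lie in a common plane. [folklore] -/
theorem rp_cols {k : ℕ} {C : Fin k → Fin k → ZMod 2} (hd : ∀ i, C i i = 0) (hs : ∀ i j, C i j = C j i)
    (hpl : ∀ i j i' j', C i j * C i' j' + C i i' * C j j' + C i j' * C j i' = 0) :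
    ∃ x z : Fin k → ZMod 2, ∀ t, (fun l => C l t) ∈ span (ZMod 2) ({x, z} : Set (Fin k → ZMod 2)) := by
  by_cases hC : C = 0
  · refine ⟨0, 0, fun t => ?_⟩
    have e : (fun l => C l t) = 0 := funext fun l => by rw [hC]; rfl
    rw [e]; exact Submodule.zero_mem _
  · obtain ⟨p, q, hpq⟩ := rp_exists_one hC
    exact ⟨C p, C q, rp_col (rp_nf hd hs hpl hpq).1⟩

/-- Elements of the plane `⟨row_p B, row_q B⟩` are row combinations `Σ_i s_i · row_i(B)`. [folklore] -/
theorem rp_inIm {k : ℕ} (B : Fin k → Fin k → ZMod 2) (p q : Fin k) {y : Fin k → ZMod 2}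
    (hy : y ∈ span (ZMod 2) ({B p, B q} : Set (Fin k → ZMod 2))) :
    ∃ s : Fin k → ZMod 2, ∀ l, y l = ∑ i, s i * B i l := by
  obtain ⟨α, β, rfl⟩ := Submodule.mem_span_pair.1 hy
  refine ⟨fun i => (if i = p then α else 0) + (if i = q then β else 0), fun l => ?_⟩
  simp only [Pi.add_apply, Pi.smul_apply, smul_eq_mul, add_mul, Finset.sum_add_distrib, ite_mul, zero_mul,
    Finset.sum_ite_eq', Finset.mem_univ, if_true]

/-- TWO PLANES MEET.  Let `B = row_p ∧ row_q` and `B′ = row_{p′} ∧ row_{q′}` be in normal form and suppose all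
columns of `B + B′` lie in one plane `⟨x, z⟩` (i.e. `B + B′` has rank `≤ 2`).  Then the planes `⟨row_p B, row_q B⟩`
and `⟨row_{p′} B′, row_{q′} B′⟩` share a non-zero vector. [folklore] -/
theorem rp_planesMeet :
    ∀ {k : ℕ} {B B' : Fin k → Fin k → ZMod 2} {p q p' q' : Fin k} {x z : Fin k → ZMod 2},
      (∀ l t, B l t = B p l * B q t + B q l * B p t) → B p p = 0 → B p q = 1 → B q p = 1 → B q q = 0 →
      (∀ l t, B' l t = B' p' l * B' q' t + B' q' l * B' p' t) → B' p' q' = 1 →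
      (∀ t, (fun l => B l t + B' l t) ∈ Submodule.span (ZMod 2) ({x, z} : Set (Fin k → ZMod 2))) →
      ∃ e : Fin k → ZMod 2, e ≠ 0 ∧ e ∈ Submodule.span (ZMod 2) ({B p, B q} : Set (Fin k → ZMod 2)) ∧
        e ∈ Submodule.span (ZMod 2) ({B' p', B' q'} : Set (Fin k → ZMod 2)) := by
  intro k B B' p q p' q' x z hB hpp hpq hqp hqq hB' hpq' hC
  set P := span (ZMod 2) ({B p, B q} : Set (Fin k → ZMod 2)) with hPdef
  set P' := span (ZMod 2) ({B' p', B' q'} : Set (Fin k → ZMod 2)) with hP'def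
  set Q := span (ZMod 2) ({x, z} : Set (Fin k → ZMod 2)) with hQdef
  by_contra hcon
  push Not at hcon
  have hdir : ∀ e, e ∈ P → e ∈ P' → e = 0 := fun e he he' =>
    Classical.byContradiction fun h0 => hcon e h0 he he'
  -- the columns `γ = col_p B'`, `δ = col_q B'`
  obtain ⟨γ, hγ⟩ : ∃ γ : Fin k → ZMod 2, ∀ l, γ l = B' l p := ⟨_, fun _ => rfl⟩
  obtain ⟨δ, hδ⟩ : ∃ δ : Fin k → ZMod 2, ∀ l, δ l = B' l q := ⟨_, fun _ => rfl⟩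
  have hcolB' : ∀ t, (fun l => B' l t) ∈ P' := rp_col hB'
  have hγP' : γ ∈ P' := by
    have e : (fun l => B' l p) = γ := funext fun l => (hγ l).symm
    exact e ▸ hcolB' p
  have hδP' : δ ∈ P' := by
    have e : (fun l => B' l q) = δ := funext fun l => (hδ l).symm
    exact e ▸ hcolB' q
  have hu0 : B p ≠ 0 := fun h => by
    have := congrFun h q; rw [hpq] at this; exact one_ne_zero this
  have hv0 : B q ≠ 0 := fun h => by
    have := congrFun h p; rw [hqp] at this; exact one_ne_zero this
  have huv0 : B p + B q ≠ 0 := fun h => by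
    have := congrFun h q; rw [Pi.add_apply, hpq, hqq, add_zero] at this; exact one_ne_zero this
  have huP : B p ∈ P := rp_inl _ _
  have hvP : B q ∈ P := rp_inr _ _
  -- columns `p` and `q` of `C = B + B'`
  have h1 : B p + γ ∈ Q := by
    have e : (fun l => B l p + B' l p) = B p + γ := funext fun l => by
      show B l p + B' l p = B p l + γ l
      rw [hB l p, hpp, hqp, hγ l]; ring
    exact e ▸ hC p
  have h2 : B q + δ ∈ Q := by
    have e : (fun l => B l q + B' l q) = B q + δ := funext fun l => by
      show B l q + B' l q = B q l + δ l
      rw [hB l q, hpq, hqq, hδ l]; ring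
    exact e ▸ hC q
  have h3 : B p + γ ≠ 0 := fun h => hu0 (hdir _ huP (by rw [rp_eq_of_add_eq_zero h]; exact hγP'))
  have h4 : B q + δ ≠ 0 := fun h => hv0 (hdir _ hvP (by rw [rp_eq_of_add_eq_zero h]; exact hδP'))
  have h5 : B p + γ ≠ B q + δ := fun h =>
    huv0 (hdir _ (P.add_mem huP hvP) (by rw [rp_swap_eq h]; exact P'.add_mem hγP' hδP'))
  obtain ⟨hg1, hg2⟩ := rp_K_gen h1 h2 h3 h4 h5
  have hQ : ∀ y, y ∈ Q → y ∈ span (ZMod 2) ({B p + γ, B q + δ} : Set (Fin k → ZMod 2)) :=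
    fun y hy => rp_span_pair_le hg1 hg2 hy
  -- `Q ∩ P' = 0`
  have h7 : ∀ y, y ∈ Q → y ∈ P' → y = 0 := by
    intro y hy hy'
    rcases rp_K_cases (hQ y hy) with h | h | h | h
    · exact h
    · exfalso
      refine hu0 (hdir _ huP ?_)
      have e : B p = y + γ := by rw [h, rp_add_cancel_right]
      rw [e]; exact P'.add_mem hy' hγP'
    · exfalso
      refine hv0 (hdir _ hvP ?_)
      have e : B q = y + δ := by rw [h, rp_add_cancel_right]
      rw [e]; exact P'.add_mem hy' hδP'
    · exfalso
      refine huv0 (hdir _ (P.add_mem huP hvP) ?_)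
      have e : B p + B q = y + (γ + δ) := by
        rw [h]; exact funext fun l => rp_s_four (B p l) (γ l) (B q l) (δ l)
      rw [e]; exact P'.add_mem hy' (P'.add_mem hγP' hδP')
  -- the entries of `B'`: `B' l t = v t · γ l + u t · δ l`
  have h8 : ∀ t l, B' l t = B q t * γ l + B p t * δ l := by
    intro t
    have hDP' : (fun l => B' l t) + B q t • γ + B p t • δ ∈ P' :=
      P'.add_mem (P'.add_mem (hcolB' t) (P'.smul_mem _ hγP')) (P'.smul_mem _ hδP')
    have hDQ : (fun l => B' l t) + B q t • γ + B p t • δ ∈ Q := by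
      have e : (fun l => B' l t) + B q t • γ + B p t • δ =
          (fun l => B l t + B' l t) + B q t • (B p + γ) + B p t • (B q + δ) := by
        funext l
        simp only [Pi.add_apply, Pi.smul_apply, smul_eq_mul]
        rw [hB l t]
        have h2 : (2 : ZMod 2) = 0 := by decide
        linear_combination (-(B p l * B q t + B q l * B p t)) * h2
      rw [e]
      exact Q.add_mem (Q.add_mem (hC t) (Q.smul_mem _ h1)) (Q.smul_mem _ h2)
    have hD0 := h7 _ hDQ hDP'
    intro l
    have e := congrFun hD0 l
    simp only [Pi.add_apply, Pi.smul_apply, smul_eq_mul, Pi.zero_apply] at e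
    exact rp_s_three _ _ _ e
  -- every row of `B'` lies in `P` and in `P'`, hence vanishes
  have h9 : ∀ l, (fun t => B' l t) ∈ P := fun l =>
    Submodule.mem_span_pair.2 ⟨δ l, γ l, funext fun t => by
      simp only [Pi.add_apply, Pi.smul_apply, smul_eq_mul]
      rw [h8 t l]; ring⟩
  have h10 : ∀ l, (fun t => B' l t) ∈ P' := fun l => by
    have e : (fun t => B' l t) = fun t => B' t l := funext fun t => by rw [hB' l t, hB' t l]; ring
    rw [e]; exact hcolB' l
  have h11 : B' p' q' = 0 := congrFun (hdir _ (h9 p') (h10 p')) q'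
  rw [hpq'] at h11
  exact one_ne_zero h11

end Summit.QuantumAdvantage.QuantumAdvantage.Theorems.CubicForrelation.NearExactIsExact
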